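import Mathlib
import Summits.NavierStokesRegularity.NavierStokesRegularity.Theorems.WakeRatchetTailRatchetStall
import Summits.NavierStokesRegularity.NavierStokesRegularity.Theorems.WakeRatchetTailRatchetLacunaryFrontAll
import HarnessLib

/-!
# `WakeRatchet.TailRatchet` (stmt-NavierStokesRegularity-21808) — the persistent-firing class is INHABITED
# (at large scale ratios): non-vacuity check for the stall kill criterion

The kill criterion `WakeRatchetStall.tailRatchet_false_of_persistentFiring` asks, at ARBITRARILY SMALL scale ratios,
for a uniformly bounded admissible eternal solution of an E₂(R) table with persistent forward firing.  This file
records that the hypothesis bundle is inhabited by NON-ZERO solutions at every LARGE scale ratio: the exact scalar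
dyadic DSS fronts of `WakeRatchetLacunaryFrontAll.dssWave_all_large` (lacunary end `Λ → ∞`), embedded shell-wise,
are shell-self-similar with a positive lag, hence fire persistently (`persistentFiring_of_shellSelfSimilar`).
So the criterion is not vacuous in its hypothesis shape; what is missing for stmt-21808 is the SMALL-ε₀ end
(door D4′ of the item's census, or `DyadicScalarFronts`).  MODEL lattice only; nothing about Navier–Stokes; no
item is closed.
-/

noncomputable section

set_option linter.dupNamespace false

namespace Summit.NavierStokesRegularity.NavierStokesRegularity.Theorems

namespace WakeRatchetStallInhabited

open Filter Topology
open Literature.Analysis.FluidPDE Literature.Analysis.FluidPDE.TaoCascade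
open WakeRatchetStall WakeRatchetLacunaryFrontAll

/-- A single-profile DSS family embedded shell-wise is shell-self-similar with lag `T`:
`dssEmbed 1 T Φ r (n+1) σ = dssEmbed 1 T Φ r n (σ − T)`.
[cite: Tao2016AveragedNS, §4 Lemma 4.1 (4.8); cell vocabulary (`dssEmbed`)] -/
theorem dssEmbed_one_shift (T : ℝ) (Φ : Fin 1 → ℝ → Em 4) (r : Fin 1) (n : ℤ) (σ : ℝ) :
    dssEmbed (1 : Equiv.Perm (Fin 1)) T Φ r (n + 1) σ = dssEmbed (1 : Equiv.Perm (Fin 1)) T Φ r n (σ - T) := by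
  unfold dssEmbed
  simp only [one_zpow, Equiv.Perm.coe_one, id_eq]
  push_cast
  ring_nf

/-- **The persistent-firing class is inhabited at every large scale ratio.**  For all `ε₀ ≥ E` the dyadic member
`dyadicTable ∈ E₂(2)` carries a uniformly bounded admissible (inviscid, `ν̂ = 0`) eternal solution with a level
`c > 0`, a base shell and a log-time beyond which infinitely many forward shells still reach `c` — the hypothesis
shape of `tailRatchet_false_of_persistentFiring`, at LARGE `ε₀` (where it refutes nothing).
[cite: Tao2016AveragedNS, §1.2 (dyadic model), §4 Lemma 4.1 (4.8), §6.4; cell vocabulary] -/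
theorem persistentFiring_inhabited_large :
    ∃ E : ℝ, 0 < E ∧ ∀ ε₀ : ℝ, E ≤ ε₀ → ∃ W : ℤ → ℝ → Em 4,
      IsEternalVisc ε₀ 0 dyadicTable W ∧ UniformBound W ∧ InTableClass 2 dyadicTable ∧
        ∃ c : ℝ, 0 < c ∧ ∃ (n₀ : ℤ) (σ₀ : ℝ),
          ∀ K : ℕ, ∃ j : ℕ, K ≤ j ∧ ∃ σ : ℝ, σ₀ ≤ σ ∧ c ≤ ‖W (n₀ + j) σ‖ := by
  obtain ⟨E, hE, H⟩ := dssWave_all_large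
  refine ⟨E, hE, fun ε₀ hε₀ => ?_⟩
  obtain ⟨T, Φ, hW, r, x, hne⟩ := H ε₀ hε₀
  set W : ℤ → ℝ → Em 4 := dssEmbed (1 : Equiv.Perm (Fin 1)) T Φ r with hWdef
  have hne0 : W 0 x ≠ 0 := by simpa [hWdef, dssEmbed] using hne
  have hD : ∀ (n : ℤ) (σ : ℝ), W (n + 1) σ = W n (σ - T) := fun n σ => dssEmbed_one_shift T Φ r n σ
  obtain ⟨hc, hfire⟩ := persistentFiring_of_shellSelfSimilar hW.delay_pos.le hD hne0
  exact ⟨W, (hW.isEternal_dssEmbed r).isEternalVisc, uniformBound_dssEmbed hW r,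
    inTableClass_dyadicTable le_rfl, ‖W 0 x‖, hc, 0, x, hfire⟩

end WakeRatchetStallInhabited

end Summit.NavierStokesRegularity.NavierStokesRegularity.Theorems

end
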